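import Literature.Probability.LatticeModels.PolymerPressureAnalytic
import Literature.MathematicalPhysics.QuantumFieldTheory.Balaban1983to89.B13Resummation

/-!
# Holomorphy of the truncated functionals and of the localized cluster sum in a BANACH parameter

[KoteckyPreiss1986] p. 493: *"both Z(V) and Φ^T(C) are analytic"* (in the activities); [Balaban1988RG2Cluster] p. 15:
*"Thus the activities in (2.13), and the whole sum E^{(k+1)}(X), are analytic functions of (𝐔, 𝐉), on the space
𝐔ᶜ_{k+1}(X, α₀, α₁)."*  The tree has the one-complex-parameter versions
(`Dimock2011to13.ClusterExpansionAnalytic.differentiableOn_truncatedWeight`, domain ℂ) and the Banach-parameter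
version for the Kotecký–Preiss LOGARITHM (`PolymerPressureAnalytic.differentiableOn_polymerLogZ_param`).  This module
supplies the Banach-parameter versions for the TRUNCATED FUNCTIONAL Φ^T(C) (a finite Möbius sum of KP logarithms) and
for Bałaban's X-localized cluster sum `B13Resummation.locE` ((2.13): a finite sum of Φ^T over the covering families),
in the currency `DifferentiableOn ℂ` on an open set of a complex normed parameter space (the currency of every producer
in the tree; see `B12Decay510Holo` for why `AnalyticOnNhd` is avoided on Banach domains).  Hypotheses: the activities
are complex-differentiable in the parameter, and the partition functions of the relevant families along the rays
`u • w`, `u ∈ [0,1]`, do not vanish (e.g. under the KP condition: `…_of_kp` corollaries, [KP86] Theorem p. 492).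

Consumers: the H-layer → E-layer passage of the shared one-step object (row D4's design point M2 of
`HOME/b2b-balaban-beta-an4/D4-CRUX-SOCKETS.md`: E := locE H by (2.13); holomorphy of E in the complexified background
or data follows from that of the activities H).  Cell pub-balaban, unit `b2b-balaban-beta-an4` gen 49 (row D4 owner).
HONEST FRAMING: [folklore]-level calculus over the tree's Kotecký–Preiss objects + the two printed sentences above;
nothing of Bałaban's estimates is asserted.  0 sorry.
-/

noncomputable section

open Finset Filter Topology Set

namespace Literature.Probability.LatticeModels

variable {P : Type*} [DecidableEq P] {inc : P → P → Prop} [DecidableRel inc]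
variable {E : Type*} [NormedAddCommGroup E] [NormedSpace ℂ E]

/-- **Holomorphy of the truncated functional Φ^T(C; w_z) in a Banach parameter** ([KP86] p. 493 *"both Z(V) and
Φ^T(C) are analytic"*): if the activities are complex-differentiable in `z` on an open `U` and the partition functions
of every sub-family of `C` along the rays `u • w_z` (`u ∈ [0,1]`) do not vanish on `U`, then `z ↦ Φ^T(C; w_z)` is
complex-differentiable on `U` — Φ^T(C) is the finite Möbius sum `Σ_{B ⊆ C} (−1)^{|C∖B|} log Z(B; w)` of KP logarithms
(`differentiableOn_polymerLogZ_param`). [cite: KoteckyPreiss1986, p. 493 and (3)] -/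
theorem differentiableOn_truncatedWeight_param {v : E → P → ℂ} (C : Finset P) {U : Set E} (hU : IsOpen U)
    (hv : ∀ γ ∈ C, DifferentiableOn ℂ (fun z => v z γ) U)
    (hZ : ∀ B, B ⊆ C → ∀ z ∈ U, ∀ u ∈ Set.Icc (0 : ℝ) 1,
      polymerPartitionFunction inc (fun γ => (u : ℂ) * v z γ) B ≠ 0) :
    DifferentiableOn ℂ (fun z => truncatedWeight inc (v z) C) U := by
  have h : (fun z => truncatedWeight inc (v z) C) =
      fun z => ∑ B ∈ C.powerset, (-1 : ℂ) ^ (C \ B).card * polymerLogZ inc (v z) B := by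
    funext z; rfl
  rw [h]
  refine DifferentiableOn.fun_sum fun B hB => ?_
  have hBC : B ⊆ C := Finset.mem_powerset.1 hB
  exact (differentiableOn_polymerLogZ_param B hU (fun γ hγ => hv γ (hBC hγ)) (hZ B hBC)).const_mul _

/-- The same under the Kotecký–Preiss condition on `C` for every parameter value: zero-freeness of all sub-families
along the rays ([KP86] Theorem p. 492; the KP condition is inherited by `u • w`, `0 ≤ u ≤ 1`).
[cite: KoteckyPreiss1986, Theorem p. 492 and p. 493] -/
theorem differentiableOn_truncatedWeight_param_of_kp [Std.Refl inc] [Std.Symm inc] {v : E → P → ℂ} (C : Finset P)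
    {U : Set E} (hU : IsOpen U) (hv : ∀ γ ∈ C, DifferentiableOn ℂ (fun z => v z γ) U) {a : P → ℝ}
    (hKP : ∀ z ∈ U, IsKPVolume inc (v z) a C) :
    DifferentiableOn ℂ (fun z => truncatedWeight inc (v z) C) U := by
  refine differentiableOn_truncatedWeight_param C hU hv fun B hBC z hz u hu => ?_
  have hKPu : IsKPVolume inc (fun γ => (u : ℂ) * v z γ) a C := fun γ hγ => by
    refine le_trans (Finset.sum_le_sum fun γ' _ => ?_) (hKP z hz γ hγ)
    unfold kpTerm
    refine mul_le_mul_of_nonneg_right ?_ (Real.exp_nonneg _)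
    rw [norm_mul, Complex.norm_real, Real.norm_eq_abs, abs_of_nonneg hu.1]
    exact mul_le_of_le_one_left (norm_nonneg _) hu.2
  exact polymerPartitionFunction_ne_zero_of_kp hKPu hBC

end Literature.Probability.LatticeModels

namespace Literature.MathematicalPhysics.QuantumFieldTheory.Balaban1983to89.B13Resummation

open Literature.Probability.LatticeModels
open Literature.MathematicalPhysics.QuantumFieldTheory.Balaban1983to89.B13FamilySum

variable {Dom Cube : Type*} [DecidableEq Dom] [DecidableEq Cube] [Fintype Dom]
variable (ι : Dom → Dom → Prop) [DecidableRel ι]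
variable {E : Type*} [NormedAddCommGroup E] [NormedSpace ℂ E]

/-- **Holomorphy of Bałaban's X-localized cluster sum (2.13) in a Banach parameter** — [II] p. 15 *"Thus the
activities in (2.13), and the whole sum E^{(k+1)}(X), are analytic functions of (𝐔, 𝐉) …"*: if the activities
`Z ↦ H(Z; z)` are complex-differentiable in `z` on an open `U` and the partition functions of every finite family along
the rays do not vanish on `U`, then `z ↦ locE(H(·; z))(X)` is complex-differentiable on `U` (a finite sum of truncated
functionals over the covering families of X, `differentiableOn_truncatedWeight_param`).
[cite: Balaban1988RG2Cluster, (2.13) p.14 and p.15] -/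
theorem differentiableOn_locE_param (cubes : Dom → Finset Cube) {H : E → Dom → ℂ} (X : Finset Cube) {U : Set E}
    (hU : IsOpen U) (hH : ∀ Z, DifferentiableOn ℂ (fun z => H z Z) U)
    (hZ : ∀ B : Finset Dom, ∀ z ∈ U, ∀ u ∈ Set.Icc (0 : ℝ) 1,
      polymerPartitionFunction ι (fun Z => (u : ℂ) * H z Z) B ≠ 0) :
    DifferentiableOn ℂ (fun z => locE ι cubes (H z) X) U := by
  unfold locE
  refine DifferentiableOn.fun_sum fun C _ => ?_
  exact differentiableOn_truncatedWeight_param C hU (fun Z _ => hH Z) fun B _ => hZ B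

/-- The same under the Kotecký–Preiss condition on the whole (finite) family of domains for every parameter value —
the situation of [II] §2 after (2.38)–(2.40) («α₆ sufficiently small»): all partition functions along the rays are
zero-free ([KP86] Theorem p. 492), so E^{(k+1)}(X) inherits the holomorphy of the activities H(Z).
[cite: Balaban1988RG2Cluster, p.15 and (2.39)-(2.40) p.21] -/
theorem differentiableOn_locE_param_of_kp [Std.Refl ι] [Std.Symm ι] (cubes : Dom → Finset Cube) {H : E → Dom → ℂ}
    (X : Finset Cube) {U : Set E} (hU : IsOpen U) (hH : ∀ Z, DifferentiableOn ℂ (fun z => H z Z) U) {a : Dom → ℝ}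
    (hKP : ∀ z ∈ U, IsKPVolume ι (H z) a Finset.univ) :
    DifferentiableOn ℂ (fun z => locE ι cubes (H z) X) U := by
  unfold locE
  refine DifferentiableOn.fun_sum fun C _ => ?_
  exact differentiableOn_truncatedWeight_param_of_kp C hU (fun Z _ => hH Z)
    fun z hz => (hKP z hz).mono (Finset.subset_univ C)

end Literature.MathematicalPhysics.QuantumFieldTheory.Balaban1983to89.B13Resummation

end
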